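import Literature.AlgebraicGeometry.HodgeTheory.UniversalHypersurfaceMonodromyOffMiddleDegree
import Literature.AlgebraicGeometry.HodgeTheory.UniversalHypersurfaceMonodromyIsometry
import HarnessLib

/-!
# Picard–Lefschetz data of the universal family move along paths (Voisin II §3.2.2: the cycle `δ_γ` of a
# conjugate loop is the transport of the vanishing cycle)

Family `hodge`, layer `Literature/AlgebraicGeometry/HodgeTheory`; proof file (theorems only, no definition, no
named fact). Written by the prover seat `hodge-nonav-prover-Bx` (g13, cell `hodge-nonav`) for crux K1-B
`VeryGeneralSignCommutatorsInHg` of the route `HodgeConjecture/SignSymmetricPowers` (stmt-HodgeConjecture-19716);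
the `family`-level transport-of-Picard–Lefschetz-data lemma asked for in the cell memo PROGRAMME-B2PL (19716-p2 g8,
"NOT typed: … a `family`-level transport-of-PL-data lemma"), whose `familyM` analogue is
`SignSymmetricPowersLinkTransport.exists_transportDatum`.

## The mathematics (Voisin II §3.2.2, construction of `δ_γ`; §3.1.2, the monodromy representation)

Let `π : 𝒴_U → U` be the universal family of smooth hypersurfaces of degree `d ≥ 1` in `ℙⁿ⁺¹_ℂ`, `n ≥ 1`, with a
FLAT Picard–Lefschetz coefficient `c : U(ℂ) → ℚˣ` (`IsFlatCoefficient`; such a `c` exists,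
`exists_isFlatCoefficient`). If a loop `γ` at `s'` has Picard–Lefschetz data `(δ₁, …, δ_k; c(s'))`
(`IsPicardLefschetzData`: rational transport `x ↦ x + c(s') Σ B_{s'}(x, δᵢ) δᵢ`, orthogonal `δᵢ`, parity clauses,
identity off the middle degree) and `β` is a path from `s` to `s'` with rational transport `Φ : Hⁿ(Y_{s'}) → Hⁿ(Y_s)`
along `β⁻¹`, then the conjugate loop `β · γ · β⁻¹` at `s` has the Picard–Lefschetz data `(Φδ₁, …, Φδ_k; c(s))`
(`IsPicardLefschetzData.transport`): its rational transport is `Φ ∘ T ∘ Φ⁻¹ = x ↦ x + c(s') Σ B_{s'}(Φ⁻¹x, δᵢ) Φδᵢ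
= x + c(s) Σ B_s(x, Φδᵢ) Φδᵢ` by flatness (`IsFlatCoefficient.coeff_transport`); orthogonality and the parity
clauses are carried by flatness (`c(s') B_{s'}(δᵢ, δⱼ) = c(s) B_s(Φδᵢ, Φδⱼ)`) and injectivity of `Φ`; the
off-middle clause holds for every loop (`isRatTransport_refl_loopClassUniv_of_ne`). Also recorded: rational
transports of the universal family exist along every path (`exists_isRatTransport_family`, Ehresmann +
`exists_ratTransport`).

## References

* [VoisinHodgeII2003] C. Voisin, Hodge Theory and Complex Algebraic Geometry II, CUP 2003, §3.1.2 (local systems,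
  monodromy representation), §3.2.1 Thm. 3.16, §3.2.2 (before Prop. 3.23: `δ_γ` obtained by transporting `δ` along
  `γ`), §6.2.1.
* [Deligne1974] P. Deligne, La conjecture de Weil. I, Publ. Math. IHÉS 43 (1974), (5.3) (flatness of the
  intersection form).
-/

noncomputable section

open CategoryTheory AlgebraicGeometry
open Literature.AlgebraicTopology.SingularHomology
open Literature.AlgebraicGeometry.Motives Literature.AlgebraicGeometry.Motives.UniversalHypersurface

namespace Literature.AlgebraicGeometry.HodgeTheory

section HodgeTheory

variable {n d : ℕ}

/-! ### Rational transports of the universal family exist along every path -/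

/-- **Transport in `Rᵏ π_* ℂ` of the universal family preserves rational classes** (the local system `Rᵏ π_* ℚ`;
Ehresmann for the universal family, `isHomotopicallyLocallyTrivialOn_family`), for every cohomological local
trivialisation datum `hU` (a `Prop`). [cite: VoisinHodgeII2003, §3.1.2] -/
theorem isRationalClass_transportFun_family (hd : 1 ≤ d) (k : ℕ)
    (hU : IsCohomologicallyLocallyTrivialOn (family ℂ n d) Set.univ)
    {s t : (Set.univ : Set (ComplexPoints (base ℂ n d)))} (θ : Path.Homotopic.Quotient s t)
    {α : complexBetti (fiberOver (family ℂ n d) s.1) k} (hα : IsRationalClass α) :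
    IsRationalClass (transportFun (family ℂ n d) k hU θ α) :=
  (UniversalHypersurface.isHomotopicallyLocallyTrivialOn_family n d hd).isRationalClass_transportFun
    (family ℂ n d) k θ hα

/-- **Rational transports of `Rᵏ π_* ℚ` exist along every path** of `U(ℂ)` (`exists_ratTransport` fed with
`isRationalClass_transportFun_family`). [cite: VoisinHodgeII2003, §3.1.2] -/
theorem exists_isRatTransport_family (hd : 1 ≤ d) (k : ℕ)
    (hU : IsCohomologicallyLocallyTrivialOn (family ℂ n d) Set.univ)
    {s t : (Set.univ : Set (ComplexPoints (base ℂ n d)))} (θ : Path.Homotopic.Quotient s t) :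
    ∃ T : bettiCohomology (fiberOver (family ℂ n d) s.1) k ≃ₗ[ℚ] bettiCohomology (fiberOver (family ℂ n d) t.1) k,
      IsRatTransport (family ℂ n d) k hU θ T :=
  exists_ratTransport (family ℂ n d) k hU (fun _ _ θ' _ hα ↦ isRationalClass_transportFun_family hd k hU θ' hα) θ

/-! ### Moving Picard–Lefschetz data along a path -/

namespace IsPicardLefschetzData

variable {k : ℕ} {hn : 1 ≤ n} {hd : 1 ≤ d} {hU : IsCohomologicallyLocallyTrivialOn (family ℂ n d) Set.univ}
  {c : ComplexPoints (base ℂ n d) → ℚ} {s' s : ComplexPoints (base ℂ n d)} {γ : Path s' s'}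
  {δ : Fin k → bettiCohomology (fiberOver (family ℂ n d) s') n}
  {Φ : bettiCohomology (fiberOver (family ℂ n d) s') n ≃ₗ[ℚ] bettiCohomology (fiberOver (family ℂ n d) s) n}

/-- **Picard–Lefschetz data move along paths.** For a FLAT coefficient `c` (`IsFlatCoefficient`), Picard–Lefschetz
data `(δ; c(s'))` of a loop `γ` at `s'`, a path `β` from `s` to `s'` and the rational transport `Φ` of `Rⁿ π_* ℚ`
along `β⁻¹` (from `s'` to `s`), the conjugate loop `β · γ · β⁻¹` at `s` has the Picard–Lefschetz data
`(Φ ∘ δ; c(s))`: its transport is `Φ T Φ⁻¹ = x ↦ x + c(s) Σ B_s(x, Φδᵢ) Φδᵢ` (flatness: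
`c(s') B_{s'}(Φ⁻¹x, δᵢ) = c(s) B_s(x, Φδᵢ)`), the `Φδᵢ` are orthogonal with the same parity normalisations (flatness,
`Φ` injective), and the conjugate loop acts trivially off the middle degree (`isRatTransport_refl_loopClassUniv_of_ne`).
[cite: VoisinHodgeII2003, §3.2.2 (δ_γ by transport along γ) and §3.2.1 Thm. 3.16] [cite: Deligne1974, (5.3)] -/
theorem transport (hc : IsFlatCoefficient n d hn hd hU c) (h : IsPicardLefschetzData n d k hn hd hU γ δ (c s'))
    (β : Path s s')
    (hΦ : IsRatTransport (family ℂ n d) n hU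
      (⟦β.symm.map (toUniv n d).continuous⟧ : Path.Homotopic.Quotient (toUniv n d s') (toUniv n d s)) Φ) :
    IsPicardLefschetzData n d k hn hd hU ((β.trans γ).trans β.symm) (fun i ↦ Φ (δ i)) (c s) := by
  obtain ⟨hc', horth, ⟨T, hT, hTx⟩, -, heven, hodd⟩ := h
  dsimp only at horth hTx heven hodd
  -- flatness of `c · B` along `β⁻¹`, on the cycles
  have hflat : ∀ x y : bettiCohomology (fiberOver (family ℂ n d) s') n,
      c s' * BettiUniverse.tr ((isSmoothProjectiveFamily_family ℂ hn hd).isSmoothProjective s') (n + n)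
          (BettiUniverse.cup (fiberOver (family ℂ n d) s') n n x y) =
        c s * BettiUniverse.tr ((isSmoothProjectiveFamily_family ℂ hn hd).isSmoothProjective s) (n + n)
          (BettiUniverse.cup (fiberOver (family ℂ n d) s) n n (Φ x) (Φ y)) :=
    fun x y ↦ hc.2 s' s _ Φ hΦ x y
  unfold IsPicardLefschetzData
  dsimp only
  refine ⟨hc.1 s, fun i i' hii' ↦ ?_, ⟨(Φ.symm ≪≫ₗ T) ≪≫ₗ Φ, ?_, fun x ↦ ?_⟩,
    fun k' hk' ↦ isRatTransport_refl_loopClassUniv_of_ne hn hd hU _ hk', fun hne i ↦ ?_, fun hno i ↦ ?_⟩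
  · -- orthogonality is carried by flatness
    have e := hflat (δ i) (δ i')
    rw [horth i i' hii', mul_zero] at e
    exact (mul_eq_zero.1 e.symm).resolve_left (hc.1 s)
  · -- the conjugate transport `Φ T Φ⁻¹` is the rational transport along `β · γ · β⁻¹`
    change IsRatTransport (family ℂ n d) n hU ⟦(((β.trans γ).trans β.symm).map (toUniv n d).continuous)⟧ _
    rw [Path.map_trans, Path.map_trans, ← Path.map_symm]
    have hpath : (⟦β.map (toUniv n d).continuous⟧ : Path.Homotopic.Quotient (toUniv n d s) (toUniv n d s')) =
        Path.Homotopic.Quotient.symm (⟦β.symm.map (toUniv n d).continuous⟧ :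
          Path.Homotopic.Quotient (toUniv n d s') (toUniv n d s)) := by
      change _ = (⟦(β.symm.map (toUniv n d).continuous).symm⟧ : Path.Homotopic.Quotient (toUniv n d s) (toUniv n d s'))
      rw [Path.map_symm, Path.symm_symm]
    have hΦ' : IsRatTransport (family ℂ n d) n hU
        (⟦β.map (toUniv n d).continuous⟧ : Path.Homotopic.Quotient (toUniv n d s) (toUniv n d s')) Φ.symm := by
      rw [hpath]
      exact hΦ.symm (family ℂ n d) n hU
    exact (hΦ'.trans (family ℂ n d) n hU hT).trans (family ℂ n d) n hU hΦ
  · -- the formula, by flatness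
    rw [LinearEquiv.trans_apply, LinearEquiv.trans_apply, hTx, map_add, LinearEquiv.apply_symm_apply, map_smul,
      map_sum, Finset.smul_sum, Finset.smul_sum]
    refine congrArg _ (Finset.sum_congr rfl fun i _ ↦ ?_)
    rw [map_smul, smul_smul, smul_smul, hc.coeff_transport hΦ x (δ i)]
  · -- even `n`: `c(s) B_s(Φδ, Φδ) = c(s') B_{s'}(δ, δ) = -2`, `Φδ ≠ 0`
    obtain ⟨h2, hδ0⟩ := heven hne i
    refine ⟨by rw [← hflat, h2], fun h0 ↦ hδ0 (Φ.injective (by rw [map_zero]; exact h0))⟩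
  · -- odd `n`: `B_s(Φδ, Φδ) = 0`
    have e := hflat (δ i) (δ i)
    rw [hodd hno i, mul_zero] at e
    exact (mul_eq_zero.1 e.symm).resolve_left (hc.1 s)

/-- **Existence form**: with a flat coefficient, Picard–Lefschetz data at `s'` for `γ` yield Picard–Lefschetz data at
any `s` joined to `s'` by a path `β`, for the conjugate loop `β · γ · β⁻¹`, with the coefficient `c(s)` (the rational
transport along `β⁻¹` exists by `exists_isRatTransport_family`). [cite: VoisinHodgeII2003, §3.2.2 and §3.2.1 Thm. 3.16] -/
theorem exists_transport (hc : IsFlatCoefficient n d hn hd hU c) (h : IsPicardLefschetzData n d k hn hd hU γ δ (c s'))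
    (β : Path s s') :
    ∃ δ' : Fin k → bettiCohomology (fiberOver (family ℂ n d) s) n,
      IsPicardLefschetzData n d k hn hd hU ((β.trans γ).trans β.symm) δ' (c s) := by
  obtain ⟨Φ, hΦ⟩ := exists_isRatTransport_family hd n hU
    (⟦β.symm.map (toUniv n d).continuous⟧ : Path.Homotopic.Quotient (toUniv n d s') (toUniv n d s))
  exact ⟨fun i ↦ Φ (δ i), h.transport hc β hΦ⟩

end IsPicardLefschetzData

end HodgeTheory

end Literature.AlgebraicGeometry.HodgeTheory

end
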